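import Summits.SmoothPoincare4.SmoothPoincare4.Theses.ZeroSurgeryExotic
import Summits.SmoothPoincare4.SmoothPoincare4.Theorems.ZseCruxRasmussen.Negative.Parity
import Literature.Uncategorized.Crux
import Literature.Topology.FourManifolds.MappingTorus
import Literature.Topology.FourManifolds.MappingTorusProofs
import Literature.Topology.FourManifolds.MappingTorusSymmProofs
import Literature.Topology.FourManifolds.MappingTorusFibreTwist
import Literature.Topology.FourManifolds.CircleSurgery
import Literature.Topology.FourManifolds.Diffeotopy
import Literature.Topology.FourManifolds.DehnSurgery
import Literature.Topology.FourManifolds.DehnSurgeryProofs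
import Literature.Topology.FourManifolds.DehnSurgeryTransportProofs
import Literature.Topology.FourManifolds.SliceRibbon
import Literature.Topology.FourManifolds.LeeRasmussen
import Literature.Topology.FourManifolds.Rasmussen
import Literature.Barriers.SmoothPoincare4.GluckTwistsDissolve
import HarnessLib

/-!
# Line `monodromy-kernel-engine` — skeleton v2 (gen-2 recut) for crux `ZeroSurgeryExotic.ZseCruxRasmussen`
(item stmt-SmoothPoincare4-0366, route `route-SmoothPoincare4-ZeroSurgeryExotic`, crux rank 2; idea card
`Cruxes/ZseCruxRasmussen/Ideas/monodromy-kernel-engine.md`; triage r1-1 (gen 2)/r1-2/r1-3: pass × 3; this file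
SUPERSEDES the gen-1 skeleton of the same name (3 stubs `stub_mappingTorus_isotopy/_conj/stub_kernelWitness`),
see "What changed" below.)

CRUX (fixed, never restated): there are knots `K, K' ⊂ S³` and a 3-manifold `Y` that is `0`-surgery on both,
with `K` smoothly slice and `s(K') ≠ 0` —
`∃ K K' Y s, IsIntegralSurgery (𝓡 3) Y K 0 ∧ IsIntegralSurgery (𝓡 3) Y K' 0 ∧ K.IsSmoothlySlice ∧
K'.HasRasmussenInvariant s ∧ s ≠ 0`.
THE DECL. The route file `Theses/ZeroSurgeryExotic.lean` (rev 5) keeps `ZseCruxRasmussen` as a TODO comment (it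
may not import `LeeRasmussen`); the gate relocated the ledger signature VERBATIM to
`Literature.Uncategorized.Crux` (`@[conjecture]`), which the disprover's `Disproof.lean` and the landed
`Theorems/ZseCruxRasmussen/Negative/Parity.lean` use. The composition below concludes `Literature.Uncategorized.Crux`
BY NAME (`crux_signature`: letter for letter the item's signature, by `Iff.rfl`); checked with
`ledger skeleton check … --crux stmt-SmoothPoincare4-0366 --crux-decl Literature.Uncategorized.Crux`. No local
re-declaration of the route decl is made (nothing to delete when the gate materialises it; retargeting
`ZseCruxRasmussen_of` is then a one-line `exact`).

## The line

MONODROMY-KERNEL ENGINE. For a fibred knot `K` with fibre `F° ≅ Σ_g¹` and monodromy `h ∈ Mod(F°, ∂)`, `S³₀(K)`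
is the mapping torus of the CLOSED monodromy `ĥ = cap(h) ∈ Mod(Σ_g)`; fibredness and genus are `0`-surgery
invariants (Gabai 1987) and a `Σ_g`-bundle over `S¹` with `b₁ = 1` fibres in a unique way, so the `0`-friends of
`K` are EXACTLY the bindings `K_{h'}` of open books `(F°, h')` of `S³` with `cap(h')` conjugate to `cap(h)^{±1}`,
i.e. (after conjugating) `h' = h·z`, `z ∈ 𝒦 := ker(cap) ≅ π₁(UTΣ_g)` (point pushes, boundary twist — Birman).
ENGINE: ribbon fibred seed → enumerate kernel words `z` → certify `OB(F°, hz) ≅ S³` → binding `K' = K_{hz}` →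
`τ`-profile filter → `s(K')`. A bounded null run is a CERTIFICATE for the kill switch 0368 on the sector
{seed, word length `≤ L`} (completeness of the kernel parametrisation is the delta over drilling/RBG searches).

## Lean rendering and the recut (what changed w.r.t. the gen-1 skeleton)

Gen 1 typed "`K` fibred with closed monodromy `φ`" THROUGH the surgery ("some `0`-surgery on `K` is a mapping
torus of `φ`") and registered two glue stubs (isotopy / conjugation invariance of `IsMappingTorusOf`). Those two
are in fact short corollaries of tree API — `IsOpenGluingWith.fibreTwist_of_eq` (`MappingTorusFibreTwist.lean`,
generic fibre: regluing by a fibre diffeotopy) and precomposition of the gluing embeddings with `g × id`; with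
`IsMappingTorusOf.symm` (`MappingTorusSymmProofs.lean`) also proved — so they are PROVED here
(`isMappingTorusOf_of_isDiffeotopic`, `isMappingTorusOf_conj`, `isMappingTorusOf_of_extConj`) and are no longer
stubs. The difficulty that gen 1's single witness stub hid — "exhibit `S³₀(K)` as a mapping torus" — is instead
cut along the engine's real seams, in FIBRED-KNOT CURRENCY:

* `FibresWithVia K ν F p φ` (a DEFINITION over tree vocabulary, not an interface; to be moved to
  `Literature/Topology/FourManifolds/` — definition item `defn-Knot.FibresWithVia` filed; flagged
  `tree.vendored-fact` by the file audit until it lands): the knot complement `S³ ∖ K` is a smooth mapping torus (`IsOpenGluingWith … (mappingTorusRel θ) jA jB`) of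
  the restriction `θ` of `φ : F ≃ₘ F` to the punctured closed surface `F ∖ {p}`, and on a punctured disc chart
  `d` at `p` the fibration is the STANDARD OPEN BOOK of the binding neighbourhood `ν`
  (`jA (d (r • u), s) = ν (u, r • e^{2πis})`). This is "`K` is fibred with fibre `F ∖ D̊²` and monodromy `φ|`
  (identity near `∂`)", `φ` being the CAPPED monodromy — exactly the object the engine manipulates
  (`φ = cap(h)`).
* `stub_pageFraming` (KNOWN, L): the binding neighbourhood of a fibration carries the Seifert framing `0`
  (the longitude lies on a page and bounds the compact part of it).
* `stub_zeroSurgery_of_fibresWithVia` (KNOWN, XL as a formalisation): `0`-surgery on a fibred knot is the mapping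
  torus of the capped monodromy (capping the pages with the meridian discs of the surgery solid torus; surgery
  uniqueness for a fixed framing).
* `stub_kernelWitness` (OPEN — THE BET, the card's transfer target `C⁺`): a RIBBON fibred seed `K` and a twin `K'`
  fibred over the same capped fibre `F` with capped monodromy in the EXTENDED CONJUGACY CLASS of the seed's
  (`φ'` diffeotopic to `g⁻¹φg` or to `g⁻¹φ⁻¹g` — the engine's output has `φ' = cap(hz) = cap(h)`, `g = id`; the
  `φ⁻¹` branch is the mirror branch `h⁻¹·𝒦` of triage r1-2), with `s(K') ≠ 0`. The witness no longer mentions any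
  surgery: it is "knot-complement fibrations + one Khovanov value".
* `crux_reduction` / `ZseCruxRasmussen_of` (kernel-checked, no sorry of its own): `Y := S³₀(K)`, `Y' := S³₀(K')`
  exist (`exists_isIntegralSurgery_holds`); stubs 1–2 make them mapping tori of `φ`, `φ'`; the proved glue makes
  `Y` a mapping torus of `φ'` too; UNIQUENESS of smooth mapping tori (`nonempty_diffeomorph_of_isMappingTorusOf_holds`,
  proved) gives `Y' ≅ Y`; transport the `K'`-surgery structure (`IsIntegralSurgery.of_diffeomorph_of_boundaryless`,
  proved); `K` ribbon ⇒ slice (`Knot.IsRibbon.isSmoothlySlice`, proved).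

COSTUME / SHRED check: 3 stubs; none restates the crux (stub 3 speaks of fibrations and `s` only, stubs 1–2 of one
fibred knot and its surgery only), none is the summit, SPC4 or a refuted statement (negatives index: 0 entries);
the known part is split into two lemmas with genuinely different proofs (homological: page framing; differential-
topological: capping), each ≥ L; all open-problem content sits in stub 3 by nature of an existential crux settled
by SEARCH, and stub 3 is exactly the crux on the sector {`K` ribbon fibred} re-expressed through the mechanism
(by Gabai + fibration uniqueness no witness of the sector is lost).

## Disproof.lean honoured (cdisprove cycle 2 = v3, `Cruxes/ZseCruxRasmussen/Disproof.lean`; landed part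
`Negative/Parity.lean` IMPORTED here; `Negative/Shape.lean` §1–§4 pending)

* §1 every conjunct load-bearing (`cruxWithout…_holds`): "K slice" is USED at stub 3 (`K.IsRibbon`, consumed by
  `IsRibbon.isSmoothlySlice`); the common `Y` is MANUFACTURED (stubs 1–2 + glue + uniqueness) from the monodromy
  relation; `s ≠ 0` sits in the witness (parity: `kernelWitness_two_le_abs`, from the landed Negative lemma).
* §2 dead strengthenings (`crux_false_of_sameKnot/_slicePartner/_concordant`): a twin with `s ≠ 0` is ≠ K,
  non-slice, non-concordant to `K` mod Rasmussen Thm 1; engine-side `z = 1` and PROPERTY-U words (unknotted dual ⇒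
  `0`-trace diffeomorphism ⇒ slice twin, MP Thm 3.15) are discarded a priori — §2's "must not extend to a trace
  diffeomorphism".
* §3/§5 `not_crux_iff_sVanishesOnPairs`, `killSwitch_open`: kill direction = MMSW Q9.11 (landed
  `sVanishesOnPairs_of_mmsw2023Question911Knot`; not restated here); null runs of the engine feed 0368.
* §4 `crux_witness_avoids_gluckTwist`: the balls here are Casson–Gordon handlebody-bundle balls `(V ⋊_ĥ S¹) ∪ h²`,
  no Gluck twist is asserted or needed. §7 `exoticCP2Sum_of_crux`: accepted price (`fgmw_of_line`).
* §8 topological witnesses dead: `s` is the only certificate; `τ = 0`, `Δ`, signatures are FILTERS.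
No stub is an instance of a landed Negative lemma (`Negative.Parity`: parity of `s`, consistent with `s ≠ 0`).
-/

noncomputable section

set_option linter.dupNamespace false
set_option linter.unusedVariables false

open scoped Manifold ContDiff Topology
open Set Function
open Literature.Topology.FourManifolds Literature.Uncategorized Literature.Barriers.SmoothPoincare4

namespace Summit.SmoothPoincare4.SmoothPoincare4.Cruxes.ZseCruxRasmussen.MonodromyKernelEngine

/-- Local notation: `𝔼 n = ℝⁿ` (model vector space). -/
local notation "𝔼 " n:arg => EuclideanSpace ℝ (Fin n)

/-- Local notation: `𝕊 n`, the unit sphere in `ℝⁿ⁺¹`. -/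
local notation "𝕊 " n:arg => (Metric.sphere (0 : EuclideanSpace ℝ (Fin (n + 1))) 1)

/-! ## The crux by name -/

/-- **The conclusion is the item's signature, letter for letter.** `Literature.Uncategorized.Crux` (the
gate's relocation of route item stmt-SmoothPoincare4-0366) unfolds BY `Iff.rfl` to the ledger signature.
[folklore] -/
theorem crux_signature : Crux ↔
    ∃ (K K' : Literature.Topology.FourManifolds.Knot) (Y : Type) (_ : TopologicalSpace Y)
      (_ : ChartedSpace (EuclideanSpace ℝ (Fin 3)) Y) (s : ℤ),
      Literature.Topology.FourManifolds.IsIntegralSurgery (𝓡 3) Y K 0 ∧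
      Literature.Topology.FourManifolds.IsIntegralSurgery (𝓡 3) Y K' 0 ∧
      K.IsSmoothlySlice ∧ K'.HasRasmussenInvariant s ∧ s ≠ 0 :=
  Iff.rfl

/-! ## Glue, PROVED: a smooth mapping torus only remembers the extended conjugacy class of the
mapping class of its monodromy (gen 1's stubs 1–2, now theorems) -/

section Glue

variable {E H : Type*} [NormedAddCommGroup E] [NormedSpace ℝ E] [TopologicalSpace H]
  {I : ModelWithCorners ℝ E H}
  {ET HT : Type*} [NormedAddCommGroup ET] [NormedSpace ℝ ET] [TopologicalSpace HT]
  {IT : ModelWithCorners ℝ ET HT}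
  {M : Type*} [TopologicalSpace M] [ChartedSpace H M] [IsManifold I ∞ M]
  {T : Type*} [TopologicalSpace T] [ChartedSpace HT T]

/-- **Isotopy invariance** (gen 1's `stub_mappingTorus_isotopy`, PROVED). A smooth mapping torus of `φ` is a
smooth mapping torus of every `ψ` diffeotopic to `φ`: reparametrise both cylinders by the inverse fibre
diffeotopy (the tree's `IsOpenGluingWith.fibreTwist_of_eq`, Gompf 2010 §4 ¶3, generic fibre).
[cite: GompfAGT2010, §2] -/
theorem isMappingTorusOf_of_isDiffeotopic (φ ψ : M ≃ₘ⟮I, I⟯ M)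
    (hφψ : Diffeomorph.IsDiffeotopic φ ψ) (h : IsMappingTorusOf IT T φ) :
    IsMappingTorusOf IT T ψ := by
  obtain ⟨D, hD⟩ := hφψ
  obtain ⟨jA, jB, hW⟩ := h
  have hW' : IsOpenGluingWith (I.prod 𝓘(ℝ, ℝ)) (I.prod 𝓘(ℝ, ℝ)) IT (mappingTorusRel ⇑φ) jA jB := hW
  refine ⟨_, _, hW'.fibreTwist_of_eq φ D.inv ψ ?_⟩
  intro x
  rw [Diffeotopy.inv_toFun, ← Diffeotopy.coe_stage_symm, hD]
  rfl

/-- **Conjugation invariance** (gen 1's `stub_mappingTorus_conj`, PROVED). A smooth mapping torus of `φ` is a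
smooth mapping torus of `g⁻¹ ∘ φ ∘ g = (g.trans φ).trans g.symm`: precompose both gluing embeddings with
`g × id`, which conjugates `mappingTorusRel`. [cite: GompfAGT2010, §3] -/
theorem isMappingTorusOf_conj (φ g : M ≃ₘ⟮I, I⟯ M) (h : IsMappingTorusOf IT T φ) :
    IsMappingTorusOf IT T ((g.trans φ).trans g.symm) := by
  obtain ⟨jA, jB, hA, hAo, hB, hBo, hU, hR⟩ := h
  let α : (M × ↥mappingTorusPieceOne) ≃ₘ⟮I.prod 𝓘(ℝ, ℝ), I.prod 𝓘(ℝ, ℝ)⟯ (M × ↥mappingTorusPieceOne) :=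
    g.prodCongr (Diffeomorph.refl 𝓘(ℝ, ℝ) (↥mappingTorusPieceOne) ∞)
  let β : (M × ↥mappingTorusPieceTwo) ≃ₘ⟮I.prod 𝓘(ℝ, ℝ), I.prod 𝓘(ℝ, ℝ)⟯ (M × ↥mappingTorusPieceTwo) :=
    g.prodCongr (Diffeomorph.refl 𝓘(ℝ, ℝ) (↥mappingTorusPieceTwo) ∞)
  have hsA : Surjective α := EquivLike.surjective α
  have hsB : Surjective β := EquivLike.surjective β
  refine ⟨jA ∘ α, jB ∘ β, hA.comp_diffeomorph α, ?_, hB.comp_diffeomorph β, ?_, ?_, fun a b => ?_⟩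
  · rwa [hsA.range_comp]
  · rwa [hsB.range_comp]
  · rwa [hsA.range_comp, hsB.range_comp]
  · rw [Function.comp_apply, Function.comp_apply, hR]
    have hα : α a = (g a.1, a.2) := rfl
    have hβ : β b = (g b.1, b.2) := rfl
    rw [hα, hβ]
    simp only [mappingTorusRel, Diffeomorph.coe_trans, Function.comp_apply]
    have key₁ : g b.1 = g a.1 ↔ b.1 = a.1 := g.injective.eq_iff
    have key₂ : g b.1 = φ (g a.1) ↔ b.1 = g.symm (φ (g a.1)) := by
      constructor
      · intro h'
        rw [← h', Diffeomorph.symm_apply_apply]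
      · intro h'
        rw [h', Diffeomorph.apply_symm_apply]
    rw [key₁, key₂]

/-- **Extended conjugacy.** If `ψ` is diffeotopic to a conjugate of `φ` or of `φ⁻¹`, every smooth mapping
torus of `φ` is a smooth mapping torus of `ψ` (isotopy + conjugation + the tree's `IsMappingTorusOf.symm`).
For closed surface bundles with `b₁ = 1` this is the complete list of monodromies with diffeomorphic total
space (uniqueness of the fibration; Abe–Tagami arXiv:1502.01102 §5.5) — the converse is not needed here.
[cite: HatcherAT2002, Ex. 2.48] -/
theorem isMappingTorusOf_of_extConj (φ ψ g : M ≃ₘ⟮I, I⟯ M)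
    (hrel : Diffeomorph.IsDiffeotopic ((g.trans φ).trans g.symm) ψ ∨
      Diffeomorph.IsDiffeotopic ((g.trans φ.symm).trans g.symm) ψ)
    (h : IsMappingTorusOf IT T φ) : IsMappingTorusOf IT T ψ := by
  rcases hrel with hrel | hrel
  · exact isMappingTorusOf_of_isDiffeotopic _ _ hrel (isMappingTorusOf_conj φ g h)
  · exact isMappingTorusOf_of_isDiffeotopic _ _ hrel (isMappingTorusOf_conj φ.symm g h.symm)

end Glue

/-! ## Fibred knots with capped monodromy, in tree vocabulary (a DEFINITION, not an interface) -/

/-- The punctured surface `F ∖ {p}` as an open submanifold. [folklore] -/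
def puncture (F : Type*) [TopologicalSpace F] [T1Space F] (p : F) : TopologicalSpace.Opens F :=
  ⟨{p}ᶜ, isOpen_compl_singleton⟩

/-- **`K` fibres over the circle, through the binding neighbourhood `ν`, with capped fibre `F`, puncture `p`
and capped monodromy `φ`.** There are: a self-diffeomorphism `θ` of the punctured surface `F ∖ {p}` which
is the restriction of `φ` (so `φ p = p`, `FibresWithVia.apply_puncture`); open smooth embeddings
`jA : (F ∖ {p}) × (0,1) → S³ ∖ K`, `jB : (F ∖ {p}) × (1/2,3/2) → S³ ∖ K` exhibiting the knot complement as
a SMOOTH MAPPING TORUS of `θ` (`IsOpenGluingWith … (mappingTorusRel θ) jA jB` — the pages are the slices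
`(F ∖ {p}) × {s}`, the first-return class is `θ` in the tree's direction convention); and a disc chart
`d : ℝ² → F` at `p` (`C^∞` embedding, open range, `d 0 = p`) on whose punctured unit disc the fibration is
the STANDARD OPEN BOOK near the binding: the page point `d (r • u)` (`0 < r < 1`, `u ∈ 𝕊 1`) at page angle
`s` sits at `ν (u, r • e^{2πis})` — radius in the fibre is radius in the tube, the angle around the puncture
is the knot parameter, and turning the pages is meridional rotation in `ν`. (Consequences, not clauses:
`θ = id` on the collar; the longitude of `ν` lies on a page — `stub_pageFraming`.) Honest fibred knots satisfy
this with `F` = capped page, `φ` = capped monodromy (choose `ν` thin and radially rescaled so that pages are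
radial for tube-radius `< 1`, the page flow = meridional rotation there, and the fibration direction matching
the orientation of `ν`). This is "`K` is a fibred knot with fibre `F ∖ D̊²` and monodromy `φ|`" (Rolfsen,
*Knots and Links*, §10.H–K; Stallings 1962) over the tree's `IsOpenGluingWith`, `mappingTorusRel`,
`Knot.TubularNbhd`, `circlePoint`. DEFINITION REQUEST `defn-Knot.FibresWithVia` filed (2026-08-16) to move it
(with stubs 1–2 as its named facts) to `Literature/Topology/FourManifolds`. [cite: Rolfsen1976, §10.K] -/
def FibresWithVia (K : Knot) (ν : Knot.TubularNbhd K) (F : Type) [TopologicalSpace F] [T2Space F]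
    [ChartedSpace (𝔼 2) F] (p : F) (φ : F ≃ₘ⟮𝓡 2, 𝓡 2⟯ F) : Prop :=
  ∃ (θ : ↥(puncture F p) ≃ₘ⟮𝓡 2, 𝓡 2⟯ ↥(puncture F p))
    (jA : ↥(puncture F p) × ↥mappingTorusPieceOne → ↥K.complement)
    (jB : ↥(puncture F p) × ↥mappingTorusPieceTwo → ↥K.complement)
    (d : (𝔼 2) → F),
    (∀ y : ↥(puncture F p), ((θ y : ↥(puncture F p)) : F) = φ (y : F)) ∧
    IsOpenGluingWith ((𝓡 2).prod 𝓘(ℝ, ℝ)) ((𝓡 2).prod 𝓘(ℝ, ℝ)) (𝓡 3)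
      (mappingTorusRel ⇑θ) jA jB ∧
    Manifold.IsSmoothEmbedding (𝓡 2) (𝓡 2) ∞ d ∧ IsOpen (range d) ∧ d 0 = p ∧
    (∀ (y : ↥(puncture F p)) (u : 𝕊 1) (r : ℝ), r ∈ Ioo (0 : ℝ) 1 →
      (y : F) = d (r • ((u : 𝕊 1) : 𝔼 2)) →
        (∀ s : ↥mappingTorusPieceOne,
          ((jA (y, s) : ↥K.complement) : 𝕊 3) =
            ν (u, r • ((circlePoint (2 * Real.pi * (s : ℝ)) : 𝕊 1) : 𝔼 2))) ∧
        (∀ t : ↥mappingTorusPieceTwo,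
          ((jB (y, t) : ↥K.complement) : 𝕊 3) =
            ν (u, r • ((circlePoint (2 * Real.pi * (t : ℝ)) : 𝕊 1) : 𝔼 2))))

/-- `K` is fibred with capped fibre `F`, puncture `p` and capped monodromy `φ`, through SOME binding
neighbourhood. [cite: Rolfsen1976, §10.K] -/
def FibresWith (K : Knot) (F : Type) [TopologicalSpace F] [T2Space F] [ChartedSpace (𝔼 2) F]
    (p : F) (φ : F ≃ₘ⟮𝓡 2, 𝓡 2⟯ F) : Prop :=
  ∃ ν : Knot.TubularNbhd K, FibresWithVia K ν F p φ

/-- Sanity: the capped monodromy of a fibration FIXES the puncture (`θ` is a bijection of `F ∖ {p}` agreeing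
with `φ`). [folklore] -/
theorem FibresWithVia.apply_puncture {K : Knot} {ν : Knot.TubularNbhd K} {F : Type} [TopologicalSpace F]
    [T2Space F] [ChartedSpace (𝔼 2) F] {p : F} {φ : F ≃ₘ⟮𝓡 2, 𝓡 2⟯ F}
    (h : FibresWithVia K ν F p φ) : φ p = p := by
  obtain ⟨θ, -, -, -, hθ, -⟩ := h
  by_contra hne
  obtain ⟨y, hy⟩ := (EquivLike.surjective θ) ⟨φ p, hne⟩
  have h1 : φ (y : F) = φ p := by
    rw [← hθ y, hy]
  have h2 : (y : F) = p := φ.injective h1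
  exact y.2 h2

/-! ## Stub 1 — the page framing is the Seifert framing (KNOWN, L) -/

/-- **Stub 1 (page framing = `0`-framing; KNOWN, size L).** If `K` fibres through `ν`, then `ν` has framing
`0`: the longitude `θ ↦ ν (e^{2πiθ}, ½)` of `ν` is, by the standard-open-book clause (`r = ½`, page angle
`t = 1`), the loop `θ ↦ jB (d (½ e^{2πiθ}), 1)`, i.e. the circle of radius `½` around the puncture on one page;
it bounds the compact subsurface `jB ((F ∖ d(½ D̊²)) × {1})` of that page inside `S³ ∖ K` (compact as `F` is,
orientable as an open subset of `S³` containing a product neighbourhood of it is); a loop bounding an embedded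
compact orientable surface is a product of commutators in `π₁`, so its class in `π₁(S³ ∖ K)ᵃᵇ` is trivial —
which is `ν.HasFraming 0` verbatim. Why a stub and not a remark: the tree's `HasFraming` lives in
`Abelianization (FundamentalGroup …)` and the surface-bounds ⇒ commutator-product step is not in the tree.
Why it might fail: it does not (textbook); only the formalisation is long. Sources: Rolfsen §5.D Thm 2,
§10.K (longitude of a fibred knot = fibre boundary); Burde–Zieschang *Knots* Ch. 5. [cite: Rolfsen1976, §10.K] -/
theorem stub_pageFraming :
    ∀ (K : Knot) (ν : Knot.TubularNbhd K) (F : Type) [TopologicalSpace F] [T2Space F]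
      [SecondCountableTopology F] [ChartedSpace (𝔼 2) F] [IsManifold (𝓡 2) ∞ F] [CompactSpace F]
      [ConnectedSpace F] (p : F) (φ : F ≃ₘ⟮𝓡 2, 𝓡 2⟯ F),
      FibresWithVia K ν F p φ → ν.HasFraming 0 := by
  sorry

/-! ## Stub 2 — `0`-surgery on a fibred knot is the mapping torus of the capped monodromy (KNOWN, XL) -/

/-- **Stub 2 (`S³₀(K) = T_φ` for a fibred knot; KNOWN, size XL as a formalisation).** If `K` fibres through
`ν` with capped fibre `F` and capped monodromy `φ`, `ν` has framing `0`, and `Y` is ANY `0`-surgery on `K`,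
then `Y` is a smooth mapping torus of `φ`. Proof route: (a) `Y ≅ Y_ν`, the `0`-surgery glued through THIS `ν`
(existence of `Y_ν`: the pushout construction behind `exists_isIntegralSurgery_holds`; uniqueness of integral
surgery for a fixed framing: tree named fact `nonempty_diffeomorph_of_isIntegralSurgery`, proofs in
`DehnSurgeryUniquenessProofs.lean`), and mapping tori transport along diffeomorphisms
(`IsMappingTorusOf.of_diffeomorph_of_range_eq`); (b) CAPPING: in `Y_ν` the punctured meridian discs
`{(r • u, v)}` of the new solid torus are glued onto `ν (u, r • v)`, which by the standard-open-book clause is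
the collar `d (r • u)` of the page of angle `v` (`surgeryRel ν`); so `JA (y, s) := jA (y, s)` on
`(F ∖ {p}) × (0,1)` and `JA (d w, s) := (w, e^{2πis})` (solid torus) on `d(D̊²) × (0,1)` paste (they agree on
the punctured disc) to an open smooth embedding `F × (0,1) → Y_ν`, likewise `JB` on `F × (1/2,3/2)`; the two
cover `Y_ν` and glue along `mappingTorusRel φ` because `θ = φ|` and `φ = id` on the disc
(`θ = id` on the collar follows from the clauses). This is the textbook identity "`0`-surgery on a fibred knot is
the closed monodromy's mapping torus" (Gabai 1987 §8 context; Abe–Tagami arXiv:1502.01102 §5.5 "S³₀(K) is a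
Σ_g-bundle over S¹ whose monodromy is the closed monodromy"; Rolfsen §10.K). Why it might fail: it does not
(textbook); the pasting of smooth structures along the punctured disc is the long part. [cite: AbeTagami2016, §5.5] -/
theorem stub_zeroSurgery_of_fibresWithVia :
    ∀ (K : Knot) (ν : Knot.TubularNbhd K) (F : Type) [TopologicalSpace F] [T2Space F]
      [SecondCountableTopology F] [ChartedSpace (𝔼 2) F] [IsManifold (𝓡 2) ∞ F] [CompactSpace F]
      [ConnectedSpace F] (p : F) (φ : F ≃ₘ⟮𝓡 2, 𝓡 2⟯ F)
      (Y : Type) [TopologicalSpace Y] [T2Space Y] [SecondCountableTopology Y]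
      [ChartedSpace (𝔼 3) Y] [IsManifold (𝓡 3) ∞ Y],
      FibresWithVia K ν F p φ → ν.HasFraming 0 → IsIntegralSurgery (𝓡 3) Y K 0 →
        IsMappingTorusOf (𝓡 3) Y φ := by
  sorry

/-! ## Stub 3 — THE BET: a kernel witness on a ribbon fibred seed (OPEN, XL) -/

/-- **Stub 3 (kernel witness; OPEN — the load-bearing stub, the card's transfer target `C⁺`).** There are a
RIBBON knot `K` (the fibred seed) and a knot `K'` (the kernel twin), both fibred over the same capped fibre `F`
(a closed connected smooth surface; punctures `p`, `p'`) with capped monodromies `φ`, `φ'`, such that `φ'` is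
DIFFEOTOPIC TO A CONJUGATE OF `φ` OR OF `φ⁻¹` (`[φ']` in the extended conjugacy class of `[φ]` in `Mod±(F)`),
and `s(K') = s ≠ 0`. Engine reading: `K = K_h` (binding of the open book `(F ∖ D̊², h)` of `S³`),
`K' = K_{hz}` with `z ∈ ker(cap : Mod(F ∖ D̊², ∂) → Mod(F))` and `OB(hz) ≅ S³` certified; `cap(hz) = cap(h)`,
so the relation holds with `g = id` (`conjIsotopic_of_kernelForm`), the `φ⁻¹` branch being the mirror branch
`h⁻¹·ker cap` (triage r1-2). WHY PLAUSIBLY TRUE / WHY IT MIGHT FAIL: by Gabai (fibredness and genus are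
`0`-surgery invariants, Cor. 8.3 / Abe–Tagami Rem. 5.9) and uniqueness of the fibration of a `b₁ = 1` surface
bundle, this is EXACTLY the crux restricted to the sector {`K` ribbon and fibred}: it fails iff `s` vanishes on
every `0`-friend of every ribbon fibred knot — the sector case of MMSW Question 9.11 / item 0368, OPEN (no
vanishing theorem for `s` on Casson–Gordon handlebody-bundle balls `(V ⋊ S¹) ∪ h²`: MMSW Thm 1.15 covers
`♮S¹×B³`, `♮B²×S²` fillings only; Q 9.12 on doubles is the analogy — triage r1-2). Known supply inside the sector
has `s = 0`: annulus presentations compatible with the fibre = simple pushes `z = Push(c)ⁿ` (Abe–Tagami L5.7,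
§5.5; AJOT), mostly with property U (MP Thm 3.15, Rem 6.6) hence `0`-trace-diffeomorphic slice twins; MP's 23
knots `K_i` are NOT fibred (MP p. 14), so the MP/LZ supply is disjoint from this sector (triage r1-1). Unexplored:
composite pushes (non-simple `α`) and sporadic `S³`-realisations at `n = ±1`. Price of success (Disproof §7): an
exotic `S⁴` AND an exotic `ℂℙ² #`-sum. Per-candidate obligations hidden here: the two fibration certificates
(`FibresWith`, from the open-book words), ribbon moves for the seed (once per seed), a certified ℚ-Lee/Khovanov
computation (`s` is `s_ℚ`, triage A3; parity `|s| ≥ 2`). Seeds: hyperbolic fibred ribbon genus-2 knots first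
(`8₂₀`; `10₁₄₀`-type after confirming fibredness), the square knot `T₂,₃ # T₂,₋₃` (periodic `ĥ`) as calibration
only (triage r1-1/2/3). Sources: AbeTagami arXiv:1502.01102 §5.5, L5.7, Rem 5.9, App. A; GabaiJDG1987 Cor 8.3;
CassonGordon1983; MeierZupan arXiv:1904.08527 Thm 1.7; ManolescuPiccirillo2023 Thm 3.15, Lemma 3.3;
MMSW arXiv:1910.08195 Thm 1.15, Q 9.11–9.12; Nakamura2023 Thm 3.13; DunfieldGong2025 §5 (drilling census).
[cite: AbeTagami2016, §5.5] -/
theorem stub_kernelWitness :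
    ∃ (K K' : Knot)
      (F : Type) (_ : TopologicalSpace F) (_ : T2Space F) (_ : SecondCountableTopology F)
      (_ : ChartedSpace (𝔼 2) F) (_ : IsManifold (𝓡 2) ∞ F) (_ : CompactSpace F) (_ : ConnectedSpace F)
      (p p' : F) (φ φ' g : F ≃ₘ⟮𝓡 2, 𝓡 2⟯ F) (s : ℤ),
      K.IsRibbon ∧ FibresWith K F p φ ∧ FibresWith K' F p' φ' ∧
      (Diffeomorph.IsDiffeotopic ((g.trans φ).trans g.symm) φ' ∨
        Diffeomorph.IsDiffeotopic ((g.trans φ.symm).trans g.symm) φ') ∧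
      K'.HasRasmussenInvariant s ∧ s ≠ 0 := by
  sorry

/-! ## Composition: the crux from the three stub STATEMENTS (kernel-checked, no sorry of its own) -/

/-- **Fibred knots: every `0`-surgery is the mapping torus of the capped monodromy** — stubs 1 + 2 chained,
statement-level (hypotheses are the stub statements, not the sorried stubs). [cite: AbeTagami2016, §5.5] -/
theorem isMappingTorusOf_zeroSurgery_of_fibresWith
    (h1 : ∀ (K : Knot) (ν : Knot.TubularNbhd K) (F : Type) [TopologicalSpace F] [T2Space F]
      [SecondCountableTopology F] [ChartedSpace (𝔼 2) F] [IsManifold (𝓡 2) ∞ F] [CompactSpace F]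
      [ConnectedSpace F] (p : F) (φ : F ≃ₘ⟮𝓡 2, 𝓡 2⟯ F),
      FibresWithVia K ν F p φ → ν.HasFraming 0)
    (h2 : ∀ (K : Knot) (ν : Knot.TubularNbhd K) (F : Type) [TopologicalSpace F] [T2Space F]
      [SecondCountableTopology F] [ChartedSpace (𝔼 2) F] [IsManifold (𝓡 2) ∞ F] [CompactSpace F]
      [ConnectedSpace F] (p : F) (φ : F ≃ₘ⟮𝓡 2, 𝓡 2⟯ F)
      (Y : Type) [TopologicalSpace Y] [T2Space Y] [SecondCountableTopology Y]
      [ChartedSpace (𝔼 3) Y] [IsManifold (𝓡 3) ∞ Y],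
      FibresWithVia K ν F p φ → ν.HasFraming 0 → IsIntegralSurgery (𝓡 3) Y K 0 →
        IsMappingTorusOf (𝓡 3) Y φ)
    {K : Knot} {F : Type} [TopologicalSpace F] [T2Space F] [SecondCountableTopology F]
    [ChartedSpace (𝔼 2) F] [IsManifold (𝓡 2) ∞ F] [CompactSpace F] [ConnectedSpace F]
    {p : F} {φ : F ≃ₘ⟮𝓡 2, 𝓡 2⟯ F}
    {Y : Type} [TopologicalSpace Y] [T2Space Y] [SecondCountableTopology Y]
    [ChartedSpace (𝔼 3) Y] [IsManifold (𝓡 3) ∞ Y]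
    (hK : FibresWith K F p φ) (hY : IsIntegralSurgery (𝓡 3) Y K 0) :
    IsMappingTorusOf (𝓡 3) Y φ := by
  obtain ⟨ν, hν⟩ := hK
  exact h2 K ν F p φ Y hν (h1 K ν F p φ hν) hY

/-- **The reduction** (statement-level, sorry-free, standard axioms): the three stub STATEMENTS imply the
crux's signature. From the witness take `K, K', F, p, p', φ, φ', g, s`; let `Y := S³₀(K)`, `Y' := S³₀(K')`
(`exists_isIntegralSurgery_holds`); by stubs 1–2 `Y` is a mapping torus of `φ` and `Y'` of `φ'`; by the PROVED
glue `Y` is also a mapping torus of `φ'`; uniqueness of smooth mapping tori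
(`nonempty_diffeomorph_of_isMappingTorusOf_holds`, PROVED) gives `Y' ≅ Y`; transport the `K'`-surgery
structure (`IsIntegralSurgery.of_diffeomorph_of_boundaryless`, PROVED); `K` ribbon ⇒ smoothly slice
(`Knot.IsRibbon.isSmoothlySlice`, PROVED). (The conclusion is spelled out rather than named `Crux` so that the
skeleton audit sees exactly ONE theorem concluding the crux by name: `ZseCruxRasmussen_of`.)
[cite: ManolescuPiccirillo2023, §1 p. 1] -/
theorem crux_reduction
    (h1 : ∀ (K : Knot) (ν : Knot.TubularNbhd K) (F : Type) [TopologicalSpace F] [T2Space F]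
      [SecondCountableTopology F] [ChartedSpace (𝔼 2) F] [IsManifold (𝓡 2) ∞ F] [CompactSpace F]
      [ConnectedSpace F] (p : F) (φ : F ≃ₘ⟮𝓡 2, 𝓡 2⟯ F),
      FibresWithVia K ν F p φ → ν.HasFraming 0)
    (h2 : ∀ (K : Knot) (ν : Knot.TubularNbhd K) (F : Type) [TopologicalSpace F] [T2Space F]
      [SecondCountableTopology F] [ChartedSpace (𝔼 2) F] [IsManifold (𝓡 2) ∞ F] [CompactSpace F]
      [ConnectedSpace F] (p : F) (φ : F ≃ₘ⟮𝓡 2, 𝓡 2⟯ F)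
      (Y : Type) [TopologicalSpace Y] [T2Space Y] [SecondCountableTopology Y]
      [ChartedSpace (𝔼 3) Y] [IsManifold (𝓡 3) ∞ Y],
      FibresWithVia K ν F p φ → ν.HasFraming 0 → IsIntegralSurgery (𝓡 3) Y K 0 →
        IsMappingTorusOf (𝓡 3) Y φ)
    (h3 : ∃ (K K' : Knot)
      (F : Type) (_ : TopologicalSpace F) (_ : T2Space F) (_ : SecondCountableTopology F)
      (_ : ChartedSpace (𝔼 2) F) (_ : IsManifold (𝓡 2) ∞ F) (_ : CompactSpace F) (_ : ConnectedSpace F)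
      (p p' : F) (φ φ' g : F ≃ₘ⟮𝓡 2, 𝓡 2⟯ F) (s : ℤ),
      K.IsRibbon ∧ FibresWith K F p φ ∧ FibresWith K' F p' φ' ∧
      (Diffeomorph.IsDiffeotopic ((g.trans φ).trans g.symm) φ' ∨
        Diffeomorph.IsDiffeotopic ((g.trans φ.symm).trans g.symm) φ') ∧
      K'.HasRasmussenInvariant s ∧ s ≠ 0) :
    ∃ (K K' : Knot) (Y : Type) (_ : TopologicalSpace Y) (_ : ChartedSpace (𝔼 3) Y) (s : ℤ),
      IsIntegralSurgery (𝓡 3) Y K 0 ∧ IsIntegralSurgery (𝓡 3) Y K' 0 ∧ K.IsSmoothlySlice ∧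
        K'.HasRasmussenInvariant s ∧ s ≠ 0 := by
  obtain ⟨K, K', F, _, _, _, _, _, _, _, p, p', φ, φ', g, s, hrib, hK, hK', hrel, hs, hs0⟩ := h3
  obtain ⟨Y, _, _, _, _, _, _, hY⟩ := exists_isIntegralSurgery_holds K 0
  obtain ⟨Y', _, _, _, _, _, _, hY'⟩ := exists_isIntegralSurgery_holds K' 0
  have hTφ : IsMappingTorusOf (𝓡 3) Y φ := isMappingTorusOf_zeroSurgery_of_fibresWith h1 h2 hK hY
  have hTφ' : IsMappingTorusOf (𝓡 3) Y' φ' :=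
    isMappingTorusOf_zeroSurgery_of_fibresWith h1 h2 hK' hY'
  have hT : IsMappingTorusOf (𝓡 3) Y φ' := isMappingTorusOf_of_extConj φ φ' g hrel hTφ
  obtain ⟨e⟩ := nonempty_diffeomorph_of_isMappingTorusOf_holds (T := Y') (T' := Y) hTφ' hT
  exact ⟨K, K', Y, _, _, s, hY, hY'.of_diffeomorph_of_boundaryless e, hrib.isSmoothlySlice, hs, hs0⟩

/-- **Composition — `Literature.Uncategorized.Crux` (= item stmt-SmoothPoincare4-0366 verbatim) BY NAME from the
three registered stubs.** `sorryAx` enters only through `stub_pageFraming`, `stub_zeroSurgery_of_fibresWithVia`,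
`stub_kernelWitness`; the reduction itself is `crux_reduction`. [cite: ManolescuPiccirillo2023, §1 p. 1] -/
theorem ZseCruxRasmussen_of : Literature.Uncategorized.Crux :=
  crux_reduction stub_pageFraming stub_zeroSurgery_of_fibresWithVia stub_kernelWitness

/-! ## Cross-links (proved): what the line reaches, kill direction, normalisations, engine output form -/

/-- The line reaches the route TARGET `ZseThesis` (item 0364) mod Rasmussen's Theorem 1 (tree named fact
`eq_zero_of_isSmoothlySlice`). [cite: Rasmussen2010, Thm. 1] -/
theorem zseThesis_of_line (hR : eq_zero_of_isSmoothlySlice) :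
    Summit.SmoothPoincare4.SmoothPoincare4.Theses.ZeroSurgeryExotic.ZseThesis := by
  obtain ⟨K, K', Y, _, _, s, hK, hK', hsl, hs, hs0⟩ := ZseCruxRasmussen_of
  exact ⟨K, K', Y, _, _, hK, hK', hsl, fun hsl' => hs0 (hR hs hsl')⟩

/-- The line implies the registered OPEN conjecture `FGMWRasmussenStrategy` (Disproof §3; with §7 this is where
the exotic-`ℂℙ²`-sum price is paid). [cite: FreedmanGompfMorrisonWalker2010, §1] -/
theorem fgmw_of_line : FGMWRasmussenStrategy :=
  fgmwRasmussenStrategy_of_crux ZseCruxRasmussen_of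

-- KILL DIRECTION (not restated here, to keep this Lines file free of `refutes`-shaped edges): a positive
-- answer to MMSW Question 9.11 kills the bet — `Literature.Uncategorized.sVanishesOnPairs_of_mmsw2023Question911Knot`
-- with `not_crux_iff_sVanishesOnPairs` (landed), and `Disproof.lean` §3/§7 (`not_crux_of_mmsw911`,
-- `not_crux_of_cp2Rigid`, `not_crux_of_spc4'`).

/-- **Parity normalisation of the witness**, from the LANDED Negative lemma
`Theorems/ZseCruxRasmussen/Negative/Parity.lean` (Disproof §6): in any kernel witness `2 ≤ |s|`, so the engine
discards odd values and `|s| = 1` outright. [cite: Rasmussen2010, Prop. 3.3] -/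
theorem kernelWitness_two_le_abs {K' : Knot} {s : ℤ} (hs : K'.HasRasmussenInvariant s) (hs0 : s ≠ 0) :
    2 ≤ |s| := by
  obtain ⟨t, rfl⟩ : Even s :=
    Summit.SmoothPoincare4.SmoothPoincare4.Theorems.ZseCruxRasmussen.Negative.hasRasmussenInvariant_even hs
  have ht : t ≠ 0 := by rintro rfl; exact hs0 (by simp)
  rw [← two_mul, abs_mul, abs_two]
  have : 1 ≤ |t| := Int.one_le_abs ht
  linarith

/-- **Kernel form of the witness relation** (the engine's literal output): if the twin's capped monodromy is
`φ.trans ζ` (`cap(h)` followed by `cap(z)`) with `ζ` diffeotopic to the identity (`z ∈ ker cap`, Birman), then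
it is diffeotopic to the conjugate of `φ` by `g = refl` — stub 3's first disjunct. [folklore] -/
theorem conjIsotopic_of_kernelForm {F : Type} [TopologicalSpace F] [ChartedSpace (𝔼 2) F]
    (φ ζ : F ≃ₘ⟮𝓡 2, 𝓡 2⟯ F) (hζ : Diffeomorph.IsDiffeotopicToId ζ) :
    Diffeomorph.IsDiffeotopic
      (((Diffeomorph.refl (𝓡 2) F ∞).trans φ).trans (Diffeomorph.refl (𝓡 2) F ∞).symm) (φ.trans ζ) := by
  rw [Diffeomorph.isDiffeotopic_iff]
  have : (((Diffeomorph.refl (𝓡 2) F ∞).trans φ).trans (Diffeomorph.refl (𝓡 2) F ∞).symm).symm.trans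
      (φ.trans ζ) = ζ := by
    ext x
    simp
  rw [this]
  exact hζ

/-- **The literal sector witness is a kernel witness.** A ribbon fibred `K` and a fibred `K'` over the same
capped fibre with the SAME capped monodromy class (the engine's normal form after conjugating: `g = id`, no
inversion) and `s(K') ≠ 0` give stub 3 — so stub 3 asks for nothing beyond the sector crux plus the engine's
own bookkeeping. [folklore] -/
theorem kernelWitness_of_sameClass {K K' : Knot} {F : Type} [TopologicalSpace F] [T2Space F]
    [SecondCountableTopology F] [ChartedSpace (𝔼 2) F] [IsManifold (𝓡 2) ∞ F] [CompactSpace F]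
    [ConnectedSpace F] {p p' : F} {φ φ' : F ≃ₘ⟮𝓡 2, 𝓡 2⟯ F} {s : ℤ}
    (hrib : K.IsRibbon) (hK : FibresWith K F p φ) (hK' : FibresWith K' F p' φ')
    (hiso : Diffeomorph.IsDiffeotopic φ φ') (hs : K'.HasRasmussenInvariant s) (hs0 : s ≠ 0) :
    ∃ (K K' : Knot)
      (F : Type) (_ : TopologicalSpace F) (_ : T2Space F) (_ : SecondCountableTopology F)
      (_ : ChartedSpace (𝔼 2) F) (_ : IsManifold (𝓡 2) ∞ F) (_ : CompactSpace F) (_ : ConnectedSpace F)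
      (p p' : F) (φ φ' g : F ≃ₘ⟮𝓡 2, 𝓡 2⟯ F) (s : ℤ),
      K.IsRibbon ∧ FibresWith K F p φ ∧ FibresWith K' F p' φ' ∧
      (Diffeomorph.IsDiffeotopic ((g.trans φ).trans g.symm) φ' ∨
        Diffeomorph.IsDiffeotopic ((g.trans φ.symm).trans g.symm) φ') ∧
      K'.HasRasmussenInvariant s ∧ s ≠ 0 := by
  refine ⟨K, K', F, inferInstance, inferInstance, inferInstance, inferInstance, inferInstance,
    inferInstance, inferInstance, p, p', φ, φ', Diffeomorph.refl (𝓡 2) F ∞, s, hrib, hK, hK',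
    Or.inl ?_, hs, hs0⟩
  have : ((Diffeomorph.refl (𝓡 2) F ∞).trans φ).trans (Diffeomorph.refl (𝓡 2) F ∞).symm = φ := by
    ext x
    simp
  rw [this]
  exact hiso

end Summit.SmoothPoincare4.SmoothPoincare4.Cruxes.ZseCruxRasmussen.MonodromyKernelEngine

end
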